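import Mathlib
import Literature.Probability.LatticeModels.ThermodynamicLimit
import Literature.Probability.LatticeModels.SharpnessProofs
import HarnessLib

/-!
# Helpers (IV) for stub `stub_kernelScaling` of line `diffusive-branch-is-nonsaturation`
(crux `PrecisionLaplacian.DirectCorrelationStableTail`, item stmt-CriticalPhenomena-4799)

**Vector bookkeeping on `ℝ³ = Fin 3 → ℝ` and the constants of the equi-Lipschitz bound.**
Elementary estimates relating `S = |w|₂²`, `M = Σ|wᵢ|`, `w·u`, `k·w` under a sup-norm perturbation
`‖w' − w‖ ≤ ρ`, and three purely real-variable inequalities (`kernSc_lip_absize`,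
`kernSc_lip_dabsize`, `kernSc_lip_combine`, the last being the registered helper sub-goal
`stub_kernelScaling_auxLipAlgebra`) which combine the scalar bounds of file (III) into
`|Δ²_u φ(w') − Δ²_u φ(w)| ≤ L ρ |u|₂²` once the growth `(1+M+S)³e^{4tM}e^{-(t/2)S} ≤ C` is absorbed.
All statements are folklore; no definitions are introduced.
-/

noncomputable section

namespace Summit.CriticalPhenomena.Ising3DConformalLimit.Cruxes.DirectCorrelationStableTail.DiffusiveBranchIsNonsaturation

open Filter Topology
open scoped BigOperators
open Literature.Probability.LatticeModels

/-! ### Vector bookkeeping on `Fin 3 → ℝ` -/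

/-- Cauchy–Schwarz: `(Σ wᵢuᵢ)² ≤ (Σ wᵢ²)(Σ uᵢ²)`. [folklore] -/
theorem kernSc_inner_sq_le (w u : Fin 3 → ℝ) :
    (∑ i, w i * u i) ^ 2 ≤ (∑ i, w i ^ 2) * ∑ i, u i ^ 2 :=
  Finset.sum_mul_sq_le_sq_mul_sq _ _ _

/-- `|u|₂ ≤ 1` forces `|uᵢ| ≤ 1`. [folklore] -/
theorem kernSc_abs_le_one_of_sum_sq_le {u : Fin 3 → ℝ} (hu : ∑ i, u i ^ 2 ≤ 1) (i : Fin 3) :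
    |u i| ≤ 1 := by
  have h1 : u i ^ 2 ≤ ∑ j, u j ^ 2 :=
    Finset.single_le_sum (f := fun j => u j ^ 2) (fun j _ => sq_nonneg (u j)) (Finset.mem_univ i)
  exact (sq_le_one_iff_abs_le_one (u i)).1 (h1.trans hu)

/-- `|Σ wᵢuᵢ| ≤ Σ |wᵢ|` when all `|uᵢ| ≤ 1`. [folklore] -/
theorem kernSc_abs_inner_le_sum_abs (w u : Fin 3 → ℝ) (hu : ∀ i, |u i| ≤ 1) :
    |∑ i, w i * u i| ≤ ∑ i, |w i| := by
  refine (Finset.abs_sum_le_sum_abs _ _).trans (Finset.sum_le_sum fun i _ => ?_)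
  rw [abs_mul]
  exact (mul_le_mul_of_nonneg_left (hu i) (abs_nonneg _)).trans (by rw [mul_one])

/-- `|Σ wᵢuᵢ| ≤ (Σ |wᵢ|)(Σ |uᵢ|)`. [folklore] -/
theorem kernSc_abs_inner_le_mul_sum_abs (w u : Fin 3 → ℝ) :
    |∑ i, w i * u i| ≤ (∑ i, |w i|) * ∑ i, |u i| := by
  refine (Finset.abs_sum_le_sum_abs _ _).trans ?_
  rw [Finset.sum_mul]
  refine Finset.sum_le_sum fun i _ => ?_
  rw [abs_mul]
  exact mul_le_mul_of_nonneg_left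
    (Finset.single_le_sum (f := fun j => |u j|) (fun j _ => abs_nonneg _) (Finset.mem_univ i))
    (abs_nonneg _)

/-- Coordinates of sup-norm-close points are close. [folklore] -/
theorem kernSc_coord_abs_le_of_norm_le {w w' : Fin 3 → ℝ} {ρ : ℝ} (h : ‖w' - w‖ ≤ ρ) (i : Fin 3) :
    |w' i - w i| ≤ ρ := by
  have h1 := norm_le_pi_norm (w' - w) i
  rw [Pi.sub_apply, Real.norm_eq_abs] at h1
  exact h1.trans h

/-- Variation of `|w|₂²` under a `ρ`-perturbation: `|S' − S| ≤ ρ(2Σ|wᵢ| + 3ρ)`. [folklore] -/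
theorem kernSc_sum_sq_sub_le (w w' : Fin 3 → ℝ) {ρ : ℝ} (hρ : 0 ≤ ρ) (h : ∀ i, |w' i - w i| ≤ ρ) :
    |∑ i, w' i ^ 2 - ∑ i, w i ^ 2| ≤ ρ * (2 * ∑ i, |w i| + 3 * ρ) := by
  rw [← Finset.sum_sub_distrib]
  refine (Finset.abs_sum_le_sum_abs _ _).trans ?_
  have hi : ∀ i, |w' i ^ 2 - w i ^ 2| ≤ ρ * (2 * |w i| + ρ) := fun i => by
    have h1 : w' i ^ 2 - w i ^ 2 = (w' i - w i) * (w' i + w i) := by ring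
    rw [h1, abs_mul]
    refine mul_le_mul (h i) ?_ (abs_nonneg _) hρ
    calc |w' i + w i| = |(w' i - w i) + 2 * w i| := by ring_nf
      _ ≤ |w' i - w i| + |2 * w i| := abs_add_le _ _
      _ ≤ ρ + 2 * |w i| := add_le_add (h i) (by rw [abs_mul, abs_two])
      _ = 2 * |w i| + ρ := by ring
  calc ∑ i, |w' i ^ 2 - w i ^ 2| ≤ ∑ i, ρ * (2 * |w i| + ρ) := Finset.sum_le_sum fun i _ => hi i
    _ = ρ * (2 * ∑ i, |w i| + 3 * ρ) := by
        rw [← Finset.mul_sum, Finset.sum_add_distrib, Finset.mul_sum]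
        simp

/-- `Σ|w'ᵢ| ≤ Σ|wᵢ| + 3ρ` under a `ρ`-perturbation. [folklore] -/
theorem kernSc_sum_abs_le_of_close (w w' : Fin 3 → ℝ) {ρ : ℝ} (h : ∀ i, |w' i - w i| ≤ ρ) :
    ∑ i, |w' i| ≤ ∑ i, |w i| + 3 * ρ := by
  have hi : ∀ i, |w' i| ≤ |w i| + ρ := fun i => by
    calc |w' i| = |w i + (w' i - w i)| := by ring_nf
      _ ≤ |w i| + |w' i - w i| := abs_add_le _ _
      _ ≤ |w i| + ρ := by linarith [h i]
  calc ∑ i, |w' i| ≤ ∑ i, (|w i| + ρ) := Finset.sum_le_sum fun i _ => hi i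
    _ = ∑ i, |w i| + 3 * ρ := by
        rw [Finset.sum_add_distrib]
        simp

/-- `|w|₂² ≤ 2|w'|₂² + 6ρ²` under a `ρ`-perturbation. [folklore] -/
theorem kernSc_sum_sq_le_two_mul_of_close (w w' : Fin 3 → ℝ) {ρ : ℝ} (h : ∀ i, |w' i - w i| ≤ ρ) :
    ∑ i, w i ^ 2 ≤ 2 * ∑ i, w' i ^ 2 + 6 * ρ ^ 2 := by
  have hi : ∀ i, w i ^ 2 ≤ 2 * w' i ^ 2 + 2 * ρ ^ 2 := fun i => by
    have h1 : (w' i - w i) ^ 2 ≤ ρ ^ 2 := by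
      rw [← sq_abs]
      exact pow_le_pow_left₀ (abs_nonneg _) (h i) 2
    nlinarith [sq_nonneg (w i - 2 * w' i)]
  calc ∑ i, w i ^ 2 ≤ ∑ i, (2 * w' i ^ 2 + 2 * ρ ^ 2) := Finset.sum_le_sum fun i _ => hi i
    _ = 2 * ∑ i, w' i ^ 2 + 6 * ρ ^ 2 := by
        rw [Finset.sum_add_distrib, Finset.mul_sum]
        simp
        ring

/-- Variation of `k·w` under a `ρ`-perturbation. [folklore] -/
theorem kernSc_abs_inner_sub_le (k w w' : Fin 3 → ℝ) {ρ : ℝ} (h : ∀ i, |w' i - w i| ≤ ρ) :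
    |∑ i, k i * w' i - ∑ i, k i * w i| ≤ (∑ i, |k i|) * ρ := by
  rw [← Finset.sum_sub_distrib]
  refine (Finset.abs_sum_le_sum_abs _ _).trans ?_
  rw [Finset.sum_mul]
  refine Finset.sum_le_sum fun i _ => ?_
  rw [← mul_sub, abs_mul]
  exact mul_le_mul_of_nonneg_left (h i) (abs_nonneg _)

/-- Variation of `w·u` under a `ρ`-perturbation of `w`. [folklore] -/
theorem kernSc_inner_sub_inner_le (w w' u : Fin 3 → ℝ) {ρ : ℝ} (h : ∀ i, |w' i - w i| ≤ ρ) :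
    |∑ i, w' i * u i - ∑ i, w i * u i| ≤ 3 * ρ * ∑ i, |u i| := by
  rw [← Finset.sum_sub_distrib]
  have h1 : ∑ i, (w' i * u i - w i * u i) = ∑ i, (w' i - w i) * u i :=
    Finset.sum_congr rfl fun i _ => by ring
  rw [h1]
  refine (kernSc_abs_inner_le_mul_sum_abs (fun i => w' i - w i) u).trans ?_
  refine mul_le_mul_of_nonneg_right ?_ (Finset.sum_nonneg fun i _ => abs_nonneg _)
  calc ∑ i, |w' i - w i| ≤ ∑ _i : Fin 3, ρ := Finset.sum_le_sum fun i _ => h i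
    _ = 3 * ρ := by simp

/-! ### Constants of the equi-Lipschitz bound -/

/-- Bookkeeping (i) for the equi-Lipschitz bound: size of `A' = |a'| + |b'|` in terms of
`S = |w|₂²`, `M = Σ|wᵢ|`, `Su = |u|₂²` (`S', M'` for the perturbed point, `B' = w'·u`, `κ = k·u`).
[folklore] -/
theorem kernSc_lip_absize {t ρ S S' M M' Su B' κ K A' : ℝ}
    (ht : 0 < t) (hρ0 : 0 ≤ ρ) (hρ1 : ρ ≤ 1) (hS0 : 0 ≤ S) (hM0 : 0 ≤ M) (hSu0 : 0 ≤ Su)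
    (hK0 : 0 ≤ K) (hM'M : M' ≤ M + 3 * ρ) (hS'S : S' ≤ S + ρ * (2 * M + 3 * ρ))
    (hB' : |B'| ≤ M') (hB'2 : B' ^ 2 ≤ S' * Su) (hκ2 : κ ^ 2 ≤ K * Su)
    (hA' : A' ≤ 2 * Real.exp (2 * |2 * t * B'|) * ((2 * t * B') ^ 2 + t * Su + κ ^ 2)) :
    A' ≤ 2 * Real.exp (12 * t) * (12 * t ^ 2 + t + K) * (Real.exp (4 * t * M) * (1 + M + S)) * Su := by
  have hM'3 : M' ≤ M + 3 := by linarith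
  have hS'3 : S' ≤ S + (2 * M + 3) := by
    have h1 : ρ * M ≤ M := mul_le_of_le_one_left hM0 hρ1
    have h2 : ρ ^ 2 ≤ 1 := pow_le_one₀ hρ0 hρ1
    have h3 : ρ * (2 * M + 3 * ρ) = 2 * (ρ * M) + 3 * ρ ^ 2 := by ring
    linarith
  have hβ'M : |2 * t * B'| ≤ 2 * t * (M + 3) := by
    rw [abs_mul, abs_of_pos (by positivity : (0 : ℝ) < 2 * t)]
    exact mul_le_mul_of_nonneg_left (hB'.trans hM'3) (by positivity)
  have h2 : Real.exp (2 * |2 * t * B'|) ≤ Real.exp (12 * t) * Real.exp (4 * t * M) := by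
    rw [← Real.exp_add]
    exact Real.exp_le_exp.2 (by linarith [hβ'M])
  have h3 : (2 * t * B') ^ 2 + t * Su + κ ^ 2 ≤ (12 * t ^ 2 + t + K) * (1 + M + S) * Su := by
    have h31 : (2 * t * B') ^ 2 + t * Su + κ ^ 2 ≤ (4 * t ^ 2 * S' + t + K) * Su := by
      have h0 : (2 * t * B') ^ 2 = 4 * t ^ 2 * B' ^ 2 := by ring
      have h1 := mul_le_mul_of_nonneg_left hB'2 (by positivity : (0 : ℝ) ≤ 4 * t ^ 2)
      have h4 : 4 * t ^ 2 * (S' * Su) + t * Su + K * Su = (4 * t ^ 2 * S' + t + K) * Su := by ring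
      linarith [hκ2]
    have h32 : 4 * t ^ 2 * S' + t + K ≤ (12 * t ^ 2 + t + K) * (1 + M + S) := by
      have h1 := mul_le_mul_of_nonneg_left hS'3 (by positivity : (0 : ℝ) ≤ 4 * t ^ 2)
      have h5 := mul_nonneg (by positivity : (0 : ℝ) ≤ t + K) (by positivity : (0 : ℝ) ≤ M + S)
      have h6 := mul_nonneg (by positivity : (0 : ℝ) ≤ t ^ 2) hM0
      have h7 := mul_nonneg (by positivity : (0 : ℝ) ≤ t ^ 2) hS0
      nlinarith [h1, h5, h6, h7]
    exact h31.trans (mul_le_mul_of_nonneg_right h32 hSu0)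
  calc A' ≤ 2 * Real.exp (2 * |2 * t * B'|) * ((2 * t * B') ^ 2 + t * Su + κ ^ 2) := hA'
    _ ≤ 2 * (Real.exp (12 * t) * Real.exp (4 * t * M)) * ((12 * t ^ 2 + t + K) * (1 + M + S) * Su) :=
        mul_le_mul (mul_le_mul_of_nonneg_left h2 zero_le_two) h3 (by positivity) (by positivity)
    _ = _ := by ring

/-- Bookkeeping (ii) for the equi-Lipschitz bound: size of `Dab = |a' − a| + |b' − b|`
(`B = w·u`, `B' = w'·u`, `U = Σ|uᵢ|`, `K₁ = Σ|kᵢ|`). [folklore] -/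
theorem kernSc_lip_dabsize {t ρ S M Su U B B' κ K₁ Dab : ℝ}
    (ht : 0 < t) (hρ0 : 0 ≤ ρ) (hρ1 : ρ ≤ 1) (hS0 : 0 ≤ S) (hM0 : 0 ≤ M) (hSu0 : 0 ≤ Su)
    (hU0 : 0 ≤ U) (hK₁0 : 0 ≤ K₁) (hU2 : U ^ 2 ≤ 3 * Su) (hU3 : U ≤ 3)
    (hκU : |κ| ≤ K₁ * U) (hBU : |B| ≤ M * U) (hBM : |B| ≤ M) (hdB : |B' - B| ≤ 3 * ρ * U)
    (hDab : Dab ≤ Real.exp (|2 * t * B| + 2 * |2 * t * B' - 2 * t * B|) * |2 * t * B' - 2 * t * B| *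
      (2 * |2 * t * B| + |2 * t * B' - 2 * t * B| + 2 * |κ|)) :
    Dab ≤ Real.exp (36 * t) * (180 * t ^ 2 + 36 * t * K₁) *
      (Real.exp (4 * t * M) * (1 + M + S)) * ρ * Su := by
  have hβM : |2 * t * B| ≤ 2 * t * M := by
    rw [abs_mul, abs_of_pos (by positivity : (0 : ℝ) < 2 * t)]
    exact mul_le_mul_of_nonneg_left hBM (by positivity)
  have hβU : |2 * t * B| ≤ 2 * t * (M * U) := by
    rw [abs_mul, abs_of_pos (by positivity : (0 : ℝ) < 2 * t)]
    exact mul_le_mul_of_nonneg_left hBU (by positivity)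
  have hη : |2 * t * B' - 2 * t * B| ≤ 6 * t * ρ * U := by
    rw [← mul_sub, abs_mul, abs_of_pos (by positivity : (0 : ℝ) < 2 * t)]
    calc 2 * t * |B' - B| ≤ 2 * t * (3 * ρ * U) := mul_le_mul_of_nonneg_left hdB (by positivity)
      _ = 6 * t * ρ * U := by ring
  have hη18 : |2 * t * B' - 2 * t * B| ≤ 18 * t := by
    have h0 : ρ * U ≤ 1 * 3 := mul_le_mul hρ1 hU3 hU0 zero_le_one
    have h1 : 6 * t * (ρ * U) ≤ 6 * t * (1 * 3) := mul_le_mul_of_nonneg_left h0 (by positivity)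
    linarith
  have h2 : Real.exp (|2 * t * B| + 2 * |2 * t * B' - 2 * t * B|) ≤
      Real.exp (36 * t) * Real.exp (4 * t * M) := by
    rw [← Real.exp_add]
    have h1 : 0 ≤ t * M := by positivity
    exact Real.exp_le_exp.2 (by linarith [hβM, hη18])
  have h3 : |2 * t * B' - 2 * t * B| * (2 * |2 * t * B| + |2 * t * B' - 2 * t * B| + 2 * |κ|) ≤
      (180 * t ^ 2 + 36 * t * K₁) * (1 + M + S) * ρ * Su := by
    have hρU : ρ * U ^ 2 ≤ 3 * ρ * Su := by
      have h1 := mul_le_mul_of_nonneg_left hU2 hρ0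
      linarith
    have hρ2U : ρ ^ 2 * U ^ 2 ≤ 3 * ρ * Su := by
      have hρ2 : ρ ^ 2 ≤ ρ := by
        rw [sq]
        exact mul_le_of_le_one_left hρ0 hρ1
      have h1 := mul_le_mul_of_nonneg_right hρ2 (sq_nonneg U)
      linarith
    calc |2 * t * B' - 2 * t * B| * (2 * |2 * t * B| + |2 * t * B' - 2 * t * B| + 2 * |κ|)
        ≤ (6 * t * ρ * U) * (2 * (2 * t * (M * U)) + 6 * t * ρ * U + 2 * (K₁ * U)) :=
          mul_le_mul hη (add_le_add (add_le_add (mul_le_mul_of_nonneg_left hβU zero_le_two) hη)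
            (mul_le_mul_of_nonneg_left hκU zero_le_two)) (by positivity) (by positivity)
      _ = (24 * t ^ 2 * M + 12 * t * K₁) * (ρ * U ^ 2) + 36 * t ^ 2 * (ρ ^ 2 * U ^ 2) := by ring
      _ ≤ (24 * t ^ 2 * M + 12 * t * K₁) * (3 * ρ * Su) + 36 * t ^ 2 * (3 * ρ * Su) :=
          add_le_add (mul_le_mul_of_nonneg_left hρU (by positivity))
            (mul_le_mul_of_nonneg_left hρ2U (by positivity))
      _ = (72 * t ^ 2 * M + 108 * t ^ 2 + 36 * t * K₁) * ρ * Su := by ring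
      _ ≤ (180 * t ^ 2 + 36 * t * K₁) * (1 + M + S) * ρ * Su := by
          apply mul_le_mul_of_nonneg_right _ hSu0
          apply mul_le_mul_of_nonneg_right _ hρ0
          have h1 := mul_nonneg (by positivity : (0 : ℝ) ≤ 36 * t * K₁) (by positivity : (0 : ℝ) ≤ M + S)
          have h4 := mul_nonneg (by positivity : (0 : ℝ) ≤ t ^ 2) hM0
          have h5 := mul_nonneg (by positivity : (0 : ℝ) ≤ t ^ 2) hS0
          nlinarith [h1, h4, h5]
  calc Dab ≤ Real.exp (|2 * t * B| + 2 * |2 * t * B' - 2 * t * B|) * |2 * t * B' - 2 * t * B| *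
        (2 * |2 * t * B| + |2 * t * B' - 2 * t * B| + 2 * |κ|) := hDab
    _ = Real.exp (|2 * t * B| + 2 * |2 * t * B' - 2 * t * B|) * (|2 * t * B' - 2 * t * B| *
        (2 * |2 * t * B| + |2 * t * B' - 2 * t * B| + 2 * |κ|)) := by ring
    _ ≤ (Real.exp (36 * t) * Real.exp (4 * t * M)) *
          ((180 * t ^ 2 + 36 * t * K₁) * (1 + M + S) * ρ * Su) :=
        mul_le_mul h2 h3 (by positivity) (by positivity)
    _ = _ := by ring

/-- Bookkeeping (iii) for the equi-Lipschitz bound: the three terms of `kernSc_Q_diff_bound`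
against the absorption constant `C`. [folklore] -/
theorem kernSc_lip_combine {t ρ S M Su K K₁ C E dE A' Da Db Θ : ℝ}
    (ht : 0 < t) (hρ0 : 0 ≤ ρ) (hM0 : 0 ≤ M) (hSu0 : 0 ≤ Su) (hK0 : 0 ≤ K) (hK₁0 : 0 ≤ K₁)
    (hC : ∀ j : ℕ, j ≤ 3 → (1 + M + S) ^ j * Real.exp (4 * t * M) * Real.exp (-(t / 2 * S)) ≤ C)
    (hA'0 : 0 ≤ A') (hDa0 : 0 ≤ Da) (hDb0 : 0 ≤ Db) (hΘ0 : 0 ≤ Θ) (hS0 : 0 ≤ S)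
    (hab' : A' ≤ 2 * Real.exp (12 * t) * (12 * t ^ 2 + t + K) * (Real.exp (4 * t * M) * (1 + M + S)) * Su)
    (hdab : Da + Db ≤ Real.exp (36 * t) * (180 * t ^ 2 + 36 * t * K₁) *
      (Real.exp (4 * t * M) * (1 + M + S)) * ρ * Su)
    (hΘ : Θ ≤ K₁ * ρ)
    (hdE : dE ≤ 3 * t * Real.exp (3 * t) * ρ * ((1 + M + S) * Real.exp (-(t / 2 * S))))
    (hEle : E ≤ Real.exp (-(t / 2 * S))) :
    dE * A' + E * (Θ * A' + Da + Db) ≤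
      (6 * t * (12 * t ^ 2 + t + K) * Real.exp (15 * t) +
          2 * K₁ * (12 * t ^ 2 + t + K) * Real.exp (12 * t) +
        Real.exp (36 * t) * (180 * t ^ 2 + 36 * t * K₁)) * C * ρ * Su := by
  set c₁ : ℝ := 12 * t ^ 2 + t + K with hc₁
  set c₃ : ℝ := 180 * t ^ 2 + 36 * t * K₁ with hc₃
  have hT1 : dE * A' ≤ 6 * t * c₁ * Real.exp (15 * t) * C * ρ * Su := by
    calc dE * A'
        ≤ (3 * t * Real.exp (3 * t) * ρ * ((1 + M + S) * Real.exp (-(t / 2 * S)))) *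
            (2 * Real.exp (12 * t) * c₁ * (Real.exp (4 * t * M) * (1 + M + S)) * Su) :=
          mul_le_mul hdE hab' hA'0 (by positivity)
      _ = 6 * t * c₁ * (Real.exp (3 * t) * Real.exp (12 * t)) *
            ((1 + M + S) ^ 2 * Real.exp (4 * t * M) * Real.exp (-(t / 2 * S))) * ρ * Su := by ring
      _ ≤ 6 * t * c₁ * Real.exp (15 * t) * C * ρ * Su := by
          rw [← Real.exp_add, show 3 * t + 12 * t = 15 * t by ring]
          apply mul_le_mul_of_nonneg_right _ hSu0
          apply mul_le_mul_of_nonneg_right _ hρ0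
          exact mul_le_mul_of_nonneg_left (hC 2 (by norm_num)) (by positivity)
  have hT2 : E * (Θ * A') ≤ 2 * K₁ * c₁ * Real.exp (12 * t) * C * ρ * Su := by
    calc E * (Θ * A')
        ≤ Real.exp (-(t / 2 * S)) * ((K₁ * ρ) *
            (2 * Real.exp (12 * t) * c₁ * (Real.exp (4 * t * M) * (1 + M + S)) * Su)) :=
          mul_le_mul hEle (mul_le_mul hΘ hab' hA'0 (by positivity)) (by positivity) (by positivity)
      _ = 2 * K₁ * c₁ * Real.exp (12 * t) *
            ((1 + M + S) ^ 1 * Real.exp (4 * t * M) * Real.exp (-(t / 2 * S))) * ρ * Su := by ring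
      _ ≤ 2 * K₁ * c₁ * Real.exp (12 * t) * C * ρ * Su := by
          apply mul_le_mul_of_nonneg_right _ hSu0
          apply mul_le_mul_of_nonneg_right _ hρ0
          exact mul_le_mul_of_nonneg_left (hC 1 (by norm_num)) (by positivity)
  have hT3 : E * (Da + Db) ≤ Real.exp (36 * t) * c₃ * C * ρ * Su := by
    calc E * (Da + Db)
        ≤ Real.exp (-(t / 2 * S)) *
            (Real.exp (36 * t) * c₃ * (Real.exp (4 * t * M) * (1 + M + S)) * ρ * Su) :=
          mul_le_mul hEle hdab (by positivity) (by positivity)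
      _ = Real.exp (36 * t) * c₃ *
            ((1 + M + S) ^ 1 * Real.exp (4 * t * M) * Real.exp (-(t / 2 * S))) * ρ * Su := by ring
      _ ≤ Real.exp (36 * t) * c₃ * C * ρ * Su := by
          apply mul_le_mul_of_nonneg_right _ hSu0
          apply mul_le_mul_of_nonneg_right _ hρ0
          exact mul_le_mul_of_nonneg_left (hC 1 (by norm_num)) (by positivity)
  calc dE * A' + E * (Θ * A' + Da + Db) = dE * A' + E * (Θ * A') + E * (Da + Db) := by ring
    _ ≤ 6 * t * c₁ * Real.exp (15 * t) * C * ρ * Su + 2 * K₁ * c₁ * Real.exp (12 * t) * C * ρ * Su +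
          Real.exp (36 * t) * c₃ * C * ρ * Su := add_le_add (add_le_add hT1 hT2) hT3
    _ = (6 * t * c₁ * Real.exp (15 * t) + 2 * K₁ * c₁ * Real.exp (12 * t) +
          Real.exp (36 * t) * c₃) * C * ρ * Su := by ring

/-- **Registered helper sub-goal `stub_kernelScaling_auxLipAlgebra`** of stub `stub_kernelScaling`
(line `diffusive-branch-is-nonsaturation`, crux stmt-CriticalPhenomena-4799): the three terms of the
variation of `E(cos θ · a − sin θ · b)` against the absorption constant `C` (see `kernSc_lip_combine`).
[folklore] -/
theorem stub_kernelScaling_auxLipAlgebra :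
    ∀ (t ρ S M Su K K₁ C E dE A' Da Db Θ : ℝ), 0 < t → 0 ≤ ρ → 0 ≤ M → 0 ≤ Su → 0 ≤ K → 0 ≤ K₁ →
      (∀ j : ℕ, j ≤ 3 → (1 + M + S) ^ j * Real.exp (4 * t * M) * Real.exp (-(t / 2 * S)) ≤ C) →
      0 ≤ A' → 0 ≤ Da → 0 ≤ Db → 0 ≤ Θ → 0 ≤ S →
      A' ≤ 2 * Real.exp (12 * t) * (12 * t ^ 2 + t + K) * (Real.exp (4 * t * M) * (1 + M + S)) * Su →
      Da + Db ≤ Real.exp (36 * t) * (180 * t ^ 2 + 36 * t * K₁) *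
        (Real.exp (4 * t * M) * (1 + M + S)) * ρ * Su →
      Θ ≤ K₁ * ρ →
      dE ≤ 3 * t * Real.exp (3 * t) * ρ * ((1 + M + S) * Real.exp (-(t / 2 * S))) →
      E ≤ Real.exp (-(t / 2 * S)) →
      dE * A' + E * (Θ * A' + Da + Db) ≤
        (6 * t * (12 * t ^ 2 + t + K) * Real.exp (15 * t) +
            2 * K₁ * (12 * t ^ 2 + t + K) * Real.exp (12 * t) +
          Real.exp (36 * t) * (180 * t ^ 2 + 36 * t * K₁)) * C * ρ * Su :=
  fun _t _ρ _S _M _Su _K _K₁ _C _E _dE _A' _Da _Db _Θ ht hρ0 hM0 hSu0 hK0 hK₁0 hC hA'0 hDa0 hDb0 hΘ0 hS0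
      hab' hdab hΘ hdE hEle =>
    kernSc_lip_combine ht hρ0 hM0 hSu0 hK0 hK₁0 hC hA'0 hDa0 hDb0 hΘ0 hS0 hab' hdab hΘ hdE hEle

end Summit.CriticalPhenomena.Ising3DConformalLimit.Cruxes.DirectCorrelationStableTail.DiffusiveBranchIsNonsaturation

end
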